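import Mathlib
import HarnessLib
import Literature.Analysis.Calculus.RadiiPolynomialTwoRadii
import Summits.NavierStokesRegularity.NavierStokesRegularity.Theorems.PicardRadiiRungThreeRadiiGlueRCore
import Literature.Analysis.FluidPDE.TaoCascadeODE
import Summits.NavierStokesRegularity.NavierStokesRegularity.Theorems.TrappingWindowRungThreeShadowingTransferWindow

/-!
# Abstract tools for `PicardRadiiRungThree.RadiiGlueR` (item stmt-NavierStokesRegularity-23947):
Newton–Kantorovich zeros of shifted maps, and Picard-integral fixed points as ODE orbits

Three pieces of folklore used by the extraction glue K1nR ⇒ K1aR of route `PicardRadiiRungThree`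
(a MODEL rung, TL-M3, of the NS ladder — Tao-type lattice cascade ODEs; nothing here is a statement
about the Navier–Stokes equations and NS regularity is NOT proved by anything in this file):

* `norm_sub_le_of_newtonLike_zero_shift` — if `T = I − A F` is a `Z`-contraction on a ball
  (`‖I − A∘F'(x)‖ ≤ Z < 1`) and `‖A‖ ≤ Λ (1 − Z)`, then a zero `P₁` of `F` and a zero `P₂` of the
  SHIFTED map `F − c` (i.e. `F P₂ = c`) in that ball satisfy `‖P₁ − P₂‖ ≤ Λ ‖c‖` (Lipschitz
  dependence of the validated zero on an additive parameter; for the Picard operator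
  `G_z(p) = p − z − h∫Q(p)` the parameter is the initial value `z`).
* `hasDerivWithinAt_IccExtend_of_picard` — a path `P ∈ C([0,1], E)` solving the Picard integral
  equation `P t = z + H • ∫₀ᵗ Q(P u) du` (with `Q` continuous) has derivative `H • Q (P t)` within
  `[0,1]` (fundamental theorem of calculus); `P 0 = z` is `RadiiGlueR.picardPath_zero` of the
  sibling file `…Theorems.PicardRadiiRungThreeRadiiGlueRCore`, whose sup-norm lemma
  `RadiiGlueR.norm_IccExtend_sub_le` is also reused.
* `hasDerivWithinAt_comp_div` — time rescaling `s ↦ P (s / H)` turns the derivative `H • f' t`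
  on `[0,1]` into `f' (s/H)` on `[0,H]`.

Stage layer (window packaging; the certificate's `let`-bound maps `fE`, `Q` are taken as ARGUMENTS
with their defining equations `hfE`, `hQ`, so the lemmas apply verbatim to the route statement):
the window space `E = Fin 4 → [−Kb, Ka] → ℝ` (sup norm), the zero extension `fE` (coordinate on the
window, `0` off it), continuity of the scaled truncated field `Q e = quadTerm 1 α (ω • fE e) / ω`
(a polynomial map, via `ShadowingTransfer.contDiff_quadTerm`), and `orbit_of_picard`: a solution of
`P t = z + H • ∫₀ᵗ Q (P u) du` gives, after unscaling and the time change `s = H t`, real functions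
`x i k s = ω k · (P (s/H))_{i,k}` solving the window-truncated cascade ODE on `[0, H]` from
`ω k · z_{i,k}`; plus the crossing parameter by the intermediate value theorem.
-/

noncomputable section

-- the sub-problem namespace repeats the summit name by design (D-0017)
set_option linter.dupNamespace false

namespace Summit.NavierStokesRegularity.NavierStokesRegularity.Theorems

namespace PicardRadii

open Set Metric Filter Topology Literature.Analysis.Calculus

section NewtonLike

variable {X Y : Type*} [NormedAddCommGroup X] [NormedSpace ℝ X]
  [NormedAddCommGroup Y] [NormedSpace ℝ Y]

/-- **Lipschitz dependence of a Newton–Kantorovich zero on an additive shift of the map.**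
If `‖I − A∘F'(x)‖ ≤ Z < 1` on the closed ball `B̄_r(x̄)`, `‖A‖ ≤ Λ (1 − Z)`, `F P₁ = 0` and
`F P₂ = c` with `P₁, P₂ ∈ B̄_r(x̄)`, then `‖P₁ − P₂‖ ≤ Λ ‖c‖`: the Newton-like map `T = I − A F`
is a `Z`-contraction on the ball (mean value inequality), `T P₁ = P₁`, `T P₂ = P₂ − A c`, so
`(1 − Z)‖P₁ − P₂‖ ≤ ‖A‖ ‖c‖`. [folklore; cite: Argyros2008, §1.1 Thm. 1.1.12 (Banach lemma
bookkeeping)] -/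
theorem norm_sub_le_of_newtonLike_zero_shift {F : X → Y} {F' : X → X →L[ℝ] Y} {xbar : X}
    {A : Y →L[ℝ] X} {Z Λ r : ℝ} {c : Y} {P₁ P₂ : X}
    (hF : ∀ x ∈ closedBall xbar r, HasFDerivAt F (F' x) x)
    (hZ : ∀ x ∈ closedBall xbar r, ‖ContinuousLinearMap.id ℝ X - A.comp (F' x)‖ ≤ Z)
    (hZ1 : Z < 1) (hA : ‖A‖ ≤ Λ * (1 - Z))
    (hP₁ : P₁ ∈ closedBall xbar r) (hP₂ : P₂ ∈ closedBall xbar r)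
    (h₁ : F P₁ = 0) (h₂ : F P₂ = c) :
    ‖P₁ - P₂‖ ≤ Λ * ‖c‖ := by
  have hlip : ‖newtonLikeMap A F P₂ - newtonLikeMap A F P₁‖ ≤ Z * ‖P₂ - P₁‖ :=
    (convex_closedBall xbar r).norm_image_sub_le_of_norm_hasFDerivWithin_le
      (fun z hz => (hasFDerivAt_newtonLikeMap (hF z hz)).hasFDerivWithinAt) hZ hP₁ hP₂
  have e1 : newtonLikeMap A F P₁ = P₁ := by
    rw [newtonLikeMap_apply, h₁, map_zero, sub_zero]
  have e2 : newtonLikeMap A F P₂ = P₂ - A c := by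
    rw [newtonLikeMap_apply, h₂]
  rw [e1, e2] at hlip
  have h3 : ‖P₂ - P₁‖ ≤ Z * ‖P₂ - P₁‖ + ‖A‖ * ‖c‖ := by
    calc ‖P₂ - P₁‖ = ‖(P₂ - A c - P₁) + A c‖ := by abel_nf
      _ ≤ ‖P₂ - A c - P₁‖ + ‖A c‖ := norm_add_le _ _
      _ ≤ Z * ‖P₂ - P₁‖ + ‖A‖ * ‖c‖ := add_le_add hlip (A.le_opNorm c)
  have h4 : (1 - Z) * ‖P₂ - P₁‖ ≤ (1 - Z) * (Λ * ‖c‖) := by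
    calc (1 - Z) * ‖P₂ - P₁‖ ≤ ‖A‖ * ‖c‖ := by linarith
      _ ≤ Λ * (1 - Z) * ‖c‖ := by gcongr
      _ = (1 - Z) * (Λ * ‖c‖) := by ring
  rw [norm_sub_rev]
  exact le_of_mul_le_mul_left h4 (by linarith)

end NewtonLike

section Picard

variable {E : Type*} [NormedAddCommGroup E] [NormedSpace ℝ E] [CompleteSpace E]

/-- **A solution of the Picard integral equation is an orbit.**  If `P ∈ C([0,1], E)` satisfies
`P t = z + H • ∫₀ᵗ Q (P u) du` on `[0,1]` with `Q : E → E` continuous, then the constant extension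
of `P` to `ℝ` has derivative `H • Q (P t)` within `[0,1]` at every `t ∈ [0,1]` (fundamental theorem
of calculus for the continuous integrand `u ↦ Q (P u)`). [folklore] -/
theorem hasDerivWithinAt_IccExtend_of_picard {Q : E → E} (hQ : Continuous Q) {z : E} {H : ℝ}
    {P : C(↥(Icc (0 : ℝ) 1), E)}
    (hP : ∀ t : ↥(Icc (0 : ℝ) 1),
      P t = z + H • ∫ u in (0 : ℝ)..(t : ℝ), Q (IccExtend zero_le_one P u))
    {t : ℝ} (ht : t ∈ Icc (0 : ℝ) 1) :
    HasDerivWithinAt (IccExtend zero_le_one P) (H • Q (IccExtend zero_le_one P t))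
      (Icc 0 1) t := by
  have hg : Continuous fun u => Q (IccExtend zero_le_one P u) :=
    hQ.comp (map_continuous P).Icc_extend'
  have hΦ : HasDerivAt (fun s => z + H • ∫ u in (0 : ℝ)..s, Q (IccExtend zero_le_one P u))
      (H • Q (IccExtend zero_le_one P t)) t :=
    ((hg.integral_hasStrictDerivAt 0 t).hasDerivAt.const_smul H).const_add z
  refine hΦ.hasDerivWithinAt.congr_of_mem (fun u hu => ?_) ht
  rw [IccExtend_of_mem zero_le_one P hu]
  exact hP ⟨u, hu⟩

omit [CompleteSpace E] in
/-- **Time rescaling.**  If `f` has derivative `H • f' t` within `[0,1]` at every `t ∈ [0,1]`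
and `H > 0`, then `s ↦ f (s / H)` has derivative `f' (s / H)` within `[0,H]` at every
`s ∈ [0,H]` (chain rule with the affine map `s ↦ s/H`). [folklore] -/
theorem hasDerivWithinAt_comp_div {f f' : ℝ → E} {H : ℝ} (hH : 0 < H)
    (hf : ∀ t ∈ Icc (0 : ℝ) 1, HasDerivWithinAt f (H • f' t) (Icc 0 1) t)
    {s : ℝ} (hs : s ∈ Icc 0 H) :
    HasDerivWithinAt (fun s => f (s / H)) (f' (s / H)) (Icc 0 H) s := by
  have hmaps : MapsTo (fun s : ℝ => s / H) (Icc 0 H) (Icc 0 1) :=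
    fun s hs => ⟨div_nonneg hs.1 hH.le, div_le_one_of_le₀ hs.2 hH.le⟩
  have hinner : HasDerivWithinAt (fun s : ℝ => s / H) (1 / H) (Icc 0 H) s :=
    ((hasDerivAt_id s).div_const H).hasDerivWithinAt
  have h := (hf (s / H) (hmaps hs)).scomp s hinner hmaps
  have hval : (1 / H) • H • f' (s / H) = f' (s / H) := by
    rw [smul_smul, one_div, inv_mul_cancel₀ hH.ne', one_smul]
  rw [hval] at h
  exact h

omit [NormedSpace ℝ E] [CompleteSpace E] in
/-- A constant path has sup norm at most the norm of its value. [folklore] -/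
theorem norm_const_le (c : E) : ‖(ContinuousMap.const ↥(Icc (0 : ℝ) 1) c)‖ ≤ ‖c‖ :=
  (ContinuousMap.norm_le _ (norm_nonneg c)).mpr fun _ => le_rfl

end Picard

end PicardRadii

end Summit.NavierStokesRegularity.NavierStokesRegularity.Theorems


namespace Summit.NavierStokesRegularity.NavierStokesRegularity.Theorems

namespace PicardRadii

open Set Metric Filter Topology Literature.Analysis.Calculus Literature.Analysis.FluidPDE
  Literature.Analysis.FluidPDE.TaoCascade

variable {Kb Ka : ℤ}

/-- Coordinates are bounded by the sup norm on the window space `Fin 4 → [−Kb, Ka] → ℝ`.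
[folklore] -/
theorem abs_apply_le_norm (e : Fin 4 → ↥(Finset.Icc (-Kb) Ka) → ℝ) (i : Fin 4)
    (n : ↥(Finset.Icc (-Kb) Ka)) : |e i n| ≤ ‖e‖ := by
  rw [← Real.norm_eq_abs]
  exact (norm_le_pi_norm (e i) n).trans (norm_le_pi_norm e i)

/-- Sup norm on the window space from coordinate bounds. [folklore] -/
theorem norm_le_of_abs_le {e : Fin 4 → ↥(Finset.Icc (-Kb) Ka) → ℝ} {C : ℝ} (hC : 0 ≤ C)
    (h : ∀ i n, |e i n| ≤ C) : ‖e‖ ≤ C := by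
  refine (pi_norm_le_iff_of_nonneg hC).mpr fun i => (pi_norm_le_iff_of_nonneg hC).mpr fun n => ?_
  rw [Real.norm_eq_abs]
  exact h i n

section Extension

variable (fE : (Fin 4 → ↥(Finset.Icc (-Kb) Ka) → ℝ) → Fin 4 → ℤ → ℝ)
  (hfE : ∀ e i n, fE e i n = if h : -Kb ≤ n ∧ n ≤ Ka then e i ⟨n, Finset.mem_Icc.mpr h⟩ else 0)
include hfE

/-- The zero extension `fE` on a window shell is the coordinate. [folklore] -/
theorem fE_of_mem (e : Fin 4 → ↥(Finset.Icc (-Kb) Ka) → ℝ) (i : Fin 4) {n : ℤ}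
    (h : -Kb ≤ n ∧ n ≤ Ka) : fE e i n = e i ⟨n, Finset.mem_Icc.mpr h⟩ := by
  rw [hfE, dif_pos h]

/-- The zero extension `fE` vanishes off the window. [folklore] -/
theorem fE_of_not_mem (e : Fin 4 → ↥(Finset.Icc (-Kb) Ka) → ℝ) (i : Fin 4) {n : ℤ}
    (h : ¬ (-Kb ≤ n ∧ n ≤ Ka)) : fE e i n = 0 := by
  rw [hfE, dif_neg h]

/-- The zero extension is 1-Lipschitz in each coordinate for the sup norm. [folklore] -/
theorem abs_fE_sub_fE_le (e e' : Fin 4 → ↥(Finset.Icc (-Kb) Ka) → ℝ) (i : Fin 4) (n : ℤ) :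
    |fE e i n - fE e' i n| ≤ ‖e - e'‖ := by
  by_cases h : -Kb ≤ n ∧ n ≤ Ka
  · rw [fE_of_mem fE hfE e i h, fE_of_mem fE hfE e' i h]
    exact abs_apply_le_norm (e - e') i ⟨n, Finset.mem_Icc.mpr h⟩
  · rw [fE_of_not_mem fE hfE e i h, fE_of_not_mem fE hfE e' i h, sub_zero, abs_zero]
    exact norm_nonneg _

/-- Each coordinate of the zero extension is `C¹` (a coordinate projection or zero). [folklore] -/
theorem contDiff_fE (i : Fin 4) (n : ℤ) : ContDiff ℝ 1 (fun e => fE e i n) := by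
  by_cases h : -Kb ≤ n ∧ n ≤ Ka
  · have heq : (fun e => fE e i n) =
        fun e : (Fin 4 → ↥(Finset.Icc (-Kb) Ka) → ℝ) => e i ⟨n, Finset.mem_Icc.mpr h⟩ :=
      funext fun e => fE_of_mem fE hfE e i h
    rw [heq]
    exact contDiff_apply_apply ℝ ℝ i (⟨n, Finset.mem_Icc.mpr h⟩ : ↥(Finset.Icc (-Kb) Ka))
  · have heq : (fun e => fE e i n) = fun _ : (Fin 4 → ↥(Finset.Icc (-Kb) Ka) → ℝ) => (0 : ℝ) :=
      funext fun e => fE_of_not_mem fE hfE e i h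
    rw [heq]
    exact contDiff_const

/-- Each coordinate of the zero extension is continuous. [folklore] -/
theorem continuous_fE (i : Fin 4) (n : ℤ) : Continuous (fun e => fE e i n) :=
  (contDiff_fE fE hfE i n).continuous

variable {α : Fin 4 → Fin 4 → Fin 4 → ℤ × ℤ × ℤ → ℝ} {ωj : ℤ → ℝ}
  (Q : (Fin 4 → ↥(Finset.Icc (-Kb) Ka) → ℝ) → (Fin 4 → ↥(Finset.Icc (-Kb) Ka) → ℝ))
  (hQ : ∀ e i (k : ↥(Finset.Icc (-Kb) Ka)),
    Q e i k = quadTerm 1 α (fun j' n (_ : ℝ) => ωj n * fE e j' n) i k 0 / ωj k)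
include hQ

/-- The scaled window-truncated cascade field `Q` is continuous (a polynomial map). [folklore] -/
theorem continuous_Q : Continuous Q := by
  have h1 : ∀ i (k : ↥(Finset.Icc (-Kb) Ka)), ContDiff ℝ 1 (fun e => Q e i k) := by
    intro i k
    have heq : (fun e => Q e i k) =
        fun e => quadTerm 1 α (fun j' n (_ : ℝ) => ωj n * fE e j' n) i k 0 / ωj k :=
      funext fun e => hQ e i k
    rw [heq]
    exact (ShadowingTransfer.contDiff_quadTerm 1 α (fun e j' n => ωj n * fE e j' n)
      (fun j' n => contDiff_const.mul (contDiff_fE fE hfE j' n)) i k).div_const _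
  have h2 : ContDiff ℝ 1 Q := contDiff_pi.mpr fun i => contDiff_pi.mpr fun k => h1 i k
  exact h2.continuous

/-- **A zero of the Picard operator is an exact window orbit.**  If `P ∈ C([0,1], E)` solves
`P t = z + H • ∫₀ᵗ Q (P u) du` (`H > 0`) for the scaled truncated field `Q`, then the unscaled
real-time coordinates `x i k s := ω k · (P (s/H))_{i,k}` (zero off the window) start at
`ω k · z_{i,k}` and solve the window-truncated cascade ODE on `[0, H]` in the sense of
`HasDerivWithinAt … (Icc 0 H)`. [folklore] -/
theorem orbit_of_picard (hω : ∀ k, 0 < ωj k) {z : Fin 4 → ↥(Finset.Icc (-Kb) Ka) → ℝ} {H : ℝ}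
    (hH : 0 < H) {P : C(↥(Icc (0 : ℝ) 1), Fin 4 → ↥(Finset.Icc (-Kb) Ka) → ℝ)}
    (hP : ∀ t : ↥(Icc (0 : ℝ) 1),
      P t = z + H • ∫ u in (0 : ℝ)..(t : ℝ), Q (IccExtend zero_le_one P u))
    (x : Fin 4 → ℤ → ℝ → ℝ)
    (hx : ∀ i k s, x i k s = ωj k * fE (IccExtend zero_le_one P (s / H)) i k) :
    (∀ i k, x i k 0 = ωj k * fE z i k) ∧
    ∀ i k, -Kb ≤ k → k ≤ Ka → ∀ s ∈ Icc 0 H, HasDerivWithinAt (x i k)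
      (quadTerm 1 α (fun j' n s' => if -Kb ≤ n ∧ n ≤ Ka then x j' n s' else 0) i k s)
      (Icc 0 H) s := by
  have hQc : Continuous Q := continuous_Q fE hfE Q hQ
  have hd1 : ∀ t ∈ Icc (0 : ℝ) 1, HasDerivWithinAt (IccExtend zero_le_one P)
      (H • Q (IccExtend zero_le_one P t)) (Icc 0 1) t :=
    fun t ht => hasDerivWithinAt_IccExtend_of_picard hQc hP ht
  have hd2 : ∀ s ∈ Icc 0 H, HasDerivWithinAt (fun s => IccExtend zero_le_one P (s / H))
      (Q (IccExtend zero_le_one P (s / H))) (Icc 0 H) s :=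
    fun s hs => hasDerivWithinAt_comp_div hH hd1 hs
  refine ⟨fun i k => by rw [hx, zero_div, RadiiGlueR.picardPath_zero hP], ?_⟩
  intro i k hk1 hk2 s hs
  have hk : -Kb ≤ k ∧ k ≤ Ka := ⟨hk1, hk2⟩
  -- the window indicator is redundant for `x`, which vanishes off the window
  have hwin : (fun j' n s' => if -Kb ≤ n ∧ n ≤ Ka then x j' n s' else 0) = x := by
    funext j' n s'
    split_ifs with h
    · rfl
    · rw [hx, fE_of_not_mem fE hfE _ _ h, mul_zero]
  rw [hwin, ShadowingTransfer.quadTerm_slice]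
  have hxf : x i k = fun s =>
      ωj k * (IccExtend zero_le_one P (s / H)) i ⟨k, Finset.mem_Icc.mpr hk⟩ := by
    funext s
    rw [hx, fE_of_mem fE hfE _ _ hk]
  have hslice : (fun j' n (_ : ℝ) => x j' n s) =
      fun j' n (_ : ℝ) => ωj n * fE (IccExtend zero_le_one P (s / H)) j' n := by
    funext j' n s'
    exact hx j' n s
  have hd3 : HasDerivWithinAt
      (fun s => (IccExtend zero_le_one P (s / H)) i ⟨k, Finset.mem_Icc.mpr hk⟩)
      ((Q (IccExtend zero_le_one P (s / H))) i ⟨k, Finset.mem_Icc.mpr hk⟩) (Icc 0 H) s :=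
    hasDerivWithinAt_pi.1 (hasDerivWithinAt_pi.1 (hd2 s hs) i) ⟨k, Finset.mem_Icc.mpr hk⟩
  have hd4 := hd3.const_mul (ωj k)
  rw [hxf, hslice]
  have hval : ωj k * (Q (IccExtend zero_le_one P (s / H))) i ⟨k, Finset.mem_Icc.mpr hk⟩ =
      quadTerm 1 α (fun j' n (_ : ℝ) => ωj n * fE (IccExtend zero_le_one P (s / H)) j' n)
        i k 0 := by
    rw [hQ]
    show ωj k * (quadTerm 1 α (fun j' n (_ : ℝ) => ωj n * fE (IccExtend zero_le_one P (s / H)) j' n)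
        i k 0 / ωj k) = _
    rw [← mul_div_assoc, mul_div_cancel_left₀ _ (hω k).ne']
  rw [← hval]
  exact hd4

end Extension

/-- **Crossing time by the intermediate value theorem.**  A continuous real function `g` on
`[T₁, T₂]` with `|g T₁| ≤ L ≤ |g T₂|` attains `|g σ| = L` at some `σ ∈ [T₁, T₂]`. [folklore] -/
theorem exists_abs_eq_of_le_of_le {g : ℝ → ℝ} (hg : Continuous g) {T₁ T₂ L : ℝ} (hT : T₁ ≤ T₂)
    (h₁ : |g T₁| ≤ L) (h₂ : L ≤ |g T₂|) : ∃ σ ∈ Icc T₁ T₂, |g σ| = L := by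
  have hc : ContinuousOn (fun t => |g t|) (Icc T₁ T₂) := (continuous_abs.comp hg).continuousOn
  obtain ⟨σ, hσ, hσL⟩ := intermediate_value_Icc hT (f := fun t => |g t|) hc ⟨h₁, h₂⟩
  exact ⟨σ, hσ, hσL⟩

end PicardRadii

end Summit.NavierStokesRegularity.NavierStokesRegularity.Theorems

namespace Summit.NavierStokesRegularity.NavierStokesRegularity.Theorems

namespace PicardRadii

open Set Metric Filter Topology

variable {Kb Ka : ℤ}

/-- Coordinates of two paths at any real time differ by at most the sup distance, through the
zero extension `fE`. [folklore] -/
theorem abs_fE_IccExtend_le (fE : (Fin 4 → ↥(Finset.Icc (-Kb) Ka) → ℝ) → Fin 4 → ℤ → ℝ)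
    (hfE : ∀ e i n, fE e i n = if h : -Kb ≤ n ∧ n ≤ Ka then e i ⟨n, Finset.mem_Icc.mpr h⟩ else 0)
    {p p' : C(↥(Icc (0 : ℝ) 1), Fin 4 → ↥(Finset.Icc (-Kb) Ka) → ℝ)} {r : ℝ} (h : ‖p - p'‖ ≤ r)
    (u : ℝ) (i : Fin 4) (n : ℤ) :
    |fE (IccExtend zero_le_one p u) i n| ≤ |fE (IccExtend zero_le_one p' u) i n| + r := by
  have h1 := abs_fE_sub_fE_le fE hfE (IccExtend zero_le_one p u) (IccExtend zero_le_one p' u) i n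
  have h2 := (RadiiGlueR.norm_IccExtend_sub_le p p' u).trans h
  have h3 := abs_sub_abs_le_abs_sub (fE (IccExtend zero_le_one p u) i n)
    (fE (IccExtend zero_le_one p' u) i n)
  linarith

/-- Scaled closeness from weighted closeness: `|y − w p| ≤ κ w ⇒ |y/w − p| ≤ κ`. [folklore] -/
theorem abs_div_sub_le {y p w κ : ℝ} (hw : 0 < w) (h : |y - w * p| ≤ κ * w) :
    |y / w - p| ≤ κ := by
  have e : y / w - p = (y - w * p) / w := by
    field_simp
  rw [e, abs_div, abs_of_pos hw, div_le_iff₀ hw]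
  exact h

/-- Scaled distance from weighted distance: `|y − y'| ≤ d w ⇒ |y/w − y'/w| ≤ d`. [folklore] -/
theorem abs_div_sub_div_le {y y' w d : ℝ} (hw : 0 < w) (h : |y - y'| ≤ d * w) :
    |y / w - y' / w| ≤ d := by
  rw [← sub_div, abs_div, abs_of_pos hw, div_le_iff₀ hw]
  exact h

end PicardRadii

end Summit.NavierStokesRegularity.NavierStokesRegularity.Theorems

end
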